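import Summits.BirchSwinnertonDyer.BirchSwinnertonDyer.Theorems.GenusKolyvaginAtTwoShaCardDvdPowAtTwoPosTOnCutRankQ
import HarnessLib

/-!
# Route `GenusKolyvaginAtTwo`, crux U⁺_T `ShaCardDvdPowAtTwoPosT` (stmt-BirchSwinnertonDyer-23378, `Δ > 0`) and the Δ>0 supply —
# THE REAL-PLACE SHIFT LAW OF THE TAMAGAWA-ODD HEEGNER TWIN: `#Sel₂(E) = 1 ⟹ #Sel₂(Wd) = 2` (the Mazur–Rubin step of supply⁺ is FREE on the
# `Ш[2] = 0` cells) and `#Sel₂(E) = 4 ∧ #Sel₂(Wd) = 2 ⟹ Sel₂(E) is NOT strict at the real place` (the second half of the R9 supply⁺ cut)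

Seat `bsd-line-gk2-p1` g20 (LEAD, cell `bsd-f1-sign2`), `--supports stmt-BirchSwinnertonDyer-23378` (helper; closes nothing).
THEOREMS ONLY (no definition, no named fact, no `sorry`); standard axioms.  BSD is NOT proved by any of this; U⁺_T is NOT proved.

WHY.  gk2-p3 g27's (RANKQ⁺) `natCard_selmerGroup_two_dvd_four_of_posDisc_of_padicValNat_eq_zero` reads the UNCONDITIONAL single-`T`-place
dichotomy `GenusKolyArch.natCard_selmerGroup_twist_shift_of_menu₅_inl` (`T = {∞}` on `Δ_E > 0`: `#Sel₂(Wd)·2 = #Sel₂(W)` or `#Sel₂(Wd) = #Sel₂(W)·2`)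
in the direction «Sel₂-minimal twin ⟹ `#Sel₂(W) ∣ 4`».  The SUPPLY needs the other direction, and here the decider of the dichotomy matters: the
twin LOWERS iff some Selmer class of `W` is non-trivial at the real place (`natCard_selmerGroup_twist_mul_two_eq_of_menu₅_inl`) and RAISES iff
`Sel₂(W)` is strict at `∞` (`natCard_selmerGroup_twist_eq_mul_two_of_menu₅_inl`).  Consequences for the R9 supply⁺ cut on `Δ > 0`
(`RESTATEMENT-R9-posdisc-cut-g20.md`): (i) on the `Ш(E/ℚ)[2] = 0` cells (`#Sel₂(E) = 1`) EVERY Tamagawa-odd Heegner twin is 2-Selmer-minimal —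
no Mazur–Rubin prime twisting is needed, the supply's open content there is only «`r_an(E^(d_K)) = 1` for some all-silent Heegner `d_K`» plus
the deep witness; (ii) on the `#Sel₂(E) = 4` cells a Tamagawa-odd 2-Selmer-minimal twin EXISTS ONLY IF `Sel₂(E)` is not strict at `∞`
(a real-place property of `Ш(E/ℚ)[2]`, NOT choosable by the supply) — so supply⁺'s narrow hypothesis must read
«`#Sel₂(E) = 1 ∨ (#Sel₂(E) = 4 ∧ Sel₂(E) not strict at ∞)`», and the real-strict `(ℤ/2)²`-cells join the declared wide residual on `Δ > 0`.

* §1 `natCard_selmerGroup_twin_eq_mul_two_or_of_posDisc_of_padicValNat_eq_zero` — the dichotomy WITH its decider, on the frame of RANKQ⁺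
  (`Δ_W > 0`, `C(W)` odd, `K` imaginary quadratic with odd `d_K`, Heegner for `N_W`, `Wd ≅ W^(d_K)` elliptic, `ord₂ C(Wd) = 0`):
  strict at `∞` ⟹ `#Sel₂(Wd) = #Sel₂(W)·2`; a class non-trivial at `∞` ⟹ `#Sel₂(Wd)·2 = #Sel₂(W)`.
* §2 `natCard_selmerGroup_twin_eq_two_of_posDisc_of_natCard_selmerGroup_eq_one` — **`#Sel₂(W) = 1 ⟹ #Sel₂(Wd) = 2`** (A⁺-alg).
* §3 `exists_selmer_localization_real_ne_zero_of_posDisc_of_minimalTwin_of_natCard_selmerGroup_eq_four` — **NECESSITY of the real-place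
  clause**: `#Sel₂(W) = 4 ∧ #Sel₂(Wd) = 2 ⟹ ∃` a Selmer class of `W` non-trivial at `∞`; and `natCard_selmerGroup_twin_eq_eight_…` — strict at
  `∞` with `#Sel₂(W) = 4` ⟹ `#Sel₂(Wd) = 8` (no Tamagawa-odd Sel₂-minimal Heegner twin on the real-strict `(ℤ/2)²`-cells).

References: [MazurRubin2010] Thm. 2.7, Lemmas 2.9–2.10, Prop. 3.3, Cor. 3.4 (i); [Kramer1981] §2 Props. 3, 6, Thm. 1; [MilneADT2006] I Thm. 4.10.
-/

set_option linter.dupNamespace false -- tree convention: `Summit.BirchSwinnertonDyer.BirchSwinnertonDyer.Theorems` (summit = sub-problem)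
set_option autoImplicit false

noncomputable section

open scoped Classical ContRepresentation

namespace Summit.BirchSwinnertonDyer.BirchSwinnertonDyer.Theorems.GenusExact.PlusDescent

open WeierstrassCurve Field NumberField IsDedekindDomain Function
open Literature.NumberTheory.EllipticCurves Literature.NumberTheory.GaloisRepresentations
open Literature.NumberTheory.GaloisRepresentations.IsNonarchimedeanLocalField (maxUnramified)
open Literature.NumberTheory.GaloisCohomology
open Summit.BirchSwinnertonDyer.BirchSwinnertonDyer.Theorems.GenusKolyTwistLocal
open Summit.BirchSwinnertonDyer.BirchSwinnertonDyer.Theorems.GenusKolyArch (natCard_ker_nsmul_eq_of_intertwining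
  embedding_of_isReal_rat_apply forall_sq_ne_completion_of_neg natCard_selmerGroup_twist_eq_mul_two_of_menu₅_inl
  natCard_selmerGroup_twist_mul_two_eq_of_menu₅_inl)
open Rat.HeightOneSpectrum (primesEquiv natGenerator)

variable (W : WeierstrassCurve ℚ) [W.IsElliptic] [W.IsGloballyMinimal]

/-! ## §1 The dichotomy with its decider -/

/-- **The real-place shift law of the Tamagawa-odd Heegner twin, WITH its decider (Mazur–Rubin Cor. 3.4 (i), `T = {∞}`).**  `W/ℚ` globally
minimal elliptic with `Δ_W > 0` and `C(W)` odd; `K` imaginary quadratic with odd `d_K`, Heegner for `N_W`; `Wd ≅ W^(d_K)` elliptic with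
`ord₂ C(Wd) = 0` (every prime of `d_K` silent).  Then: if every `2`-Selmer class of `W` is trivial at the real place, `#Sel₂(Wd) = #Sel₂(W)·2`
(the twist RAISES); if some `2`-Selmer class of `W` is non-trivial at the real place, `#Sel₂(Wd)·2 = #Sel₂(W)` (the twist LOWERS).
(Proof = gk2-p3 g27's RANKQ⁺ menu verification verbatim, then the two one-sided kernel theorems of `GenusKolyArch` instead of their disjunction.)
[cite: MazurRubin2010, Thm. 2.7, Lemmas 2.9–2.10, Prop. 3.3, Cor. 3.4 (i)] [cite: Kramer1981, §2 Props. 3, 6, Thm. 1] [cite: MilneADT2006, I Thm. 4.10] -/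
theorem natCard_selmerGroup_twin_eq_mul_two_or_of_posDisc_of_padicValNat_eq_zero {K : Type} [Field K] [NumberField K]
    (hΔ : 0 < W.Δ) (hTam : Odd W.tamagawaProduct) (hK : IsImaginaryQuadratic K) (hodd : Odd (discr K))
    (hH : SatisfiesHeegnerHypothesis (W.conductorNorm ℤ) K)
    (Wd : WeierstrassCurve ℚ) [Wd.IsElliptic] (hWd : ∃ C : VariableChange ℚ, C • W.quadraticTwist (discr K : ℚ) = Wd)
    (hDEF : padicValNat 2 Wd.tamagawaProduct = 0) :
    ((∀ c ∈ (W.kummerSelmerStructure ((2 : ℕ) : ℤ)).selmerGroup,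
        galoisCohomology.localization (W.torsionGaloisModule ((2 : ℕ) : ℤ)) (Sum.inl Rat.infinitePlace) 1 c = 0) →
      Nat.card (Wd.selmerGroup ((2 : ℕ) : ℤ)) = Nat.card (W.selmerGroup ((2 : ℕ) : ℤ)) * 2) ∧
    ((∃ c ∈ (W.kummerSelmerStructure ((2 : ℕ) : ℤ)).selmerGroup,
        galoisCohomology.localization (W.torsionGaloisModule ((2 : ℕ) : ℤ)) (Sum.inl Rat.infinitePlace) 1 c ≠ 0) →
      Nat.card (Wd.selmerGroup ((2 : ℕ) : ℤ)) * 2 = Nat.card (W.selmerGroup ((2 : ℕ) : ℤ))) := by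
  obtain ⟨Cd, hCd⟩ := hWd
  have hdneg : discr K < 0 := IsImaginaryQuadratic.discr_neg hK
  have hd0 : (discr K : ℚ) ≠ 0 := by exact_mod_cast hdneg.ne
  -- every prime of `d_K` is silent for `W`, hence for `Wd` (gk2-p3 g27 §1)
  have hsilQ := forall_twoTorsion_padic_eq_zero_of_padicValNat_two_tamagawaProduct_twin_eq_zero W hK hodd hH hTam Cd hCd hDEF
  obtain ⟨φ, ψ, hψφ, hφψ, -⟩ := exists_intertwining_master_frame W Wd hd0 hCd
  have hsil : ∀ v : HeightOneSpectrum (𝓞 ℚ), (((primesEquiv v : Nat.Primes) : ℕ) : ℤ) ∣ discr K →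
      Nat.card (nsmulAddMonoidHom 2 : (W.baseChange (v.adicCompletion ℚ)).toAffine.Point →+ _).ker = 1 ∧
      Nat.card (nsmulAddMonoidHom 2 : (Wd.baseChange (v.adicCompletion ℚ)).toAffine.Point →+ _).ker = 1 := by
    intro v hvd
    haveI := Fact.mk (primesEquiv v).2
    have hker : Nat.card (nsmulAddMonoidHom 2 : (W.baseChange (v.adicCompletion ℚ)).toAffine.Point →+ _).ker = 1 := by
      rw [natCard_ker_nsmul_adicCompletion_eq_padic W v 2]
      have h0 := hsilQ ((primesEquiv v : Nat.Primes) : ℕ) hvd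
      rw [Nat.card_eq_one_iff_unique]
      refine ⟨⟨fun a b ↦ Subtype.ext ((h0 a.1 a.2).trans (h0 b.1 b.2).symm)⟩, ⟨⟨0, by simp⟩⟩⟩
    refine ⟨hker, ?_⟩
    -- the `CharZero` / `Algebra` instances are passed explicitly so that the `ℚ`-algebra structure of `ℚ_v` stays the `adicCompletion` one
    rw [@natCard_ker_nsmul_eq_of_intertwining ℚ _ _ W Wd _ _ 2 two_ne_zero φ ψ hψφ hφψ (v.adicCompletion ℚ) _
      (HeightOneSpectrum.instAlgebraAdicCompletion (𝓞 ℚ) ℚ v) (charZero_adicCompletion v)]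
    exact hker
  -- the menus (gk2-p3 g27 §2)
  have hfin := twist_place_menu₅_finite_rat_of_all_silent W hK.1 hodd hH hCd hsil
  have hw₀ : (Rat.infinitePlace).IsReal := Rat.isReal_infinitePlace
  have hΔ' : 0 < InfinitePlace.embedding_of_isReal hw₀ W.Δ := by rwa [embedding_of_isReal_rat_apply, Rat.cast_pos]
  have hinf : ∀ w : InfinitePlace ℚ, w ≠ Rat.infinitePlace →
      (∃ s : w.Completion, s ^ 2 = algebraMap ℚ w.Completion (discr K : ℚ)) ∨
      ((∀ x : galoisCohomology (W.localGaloisModule w.Completion) 1, x = 0) ∧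
        (∀ x : galoisCohomology (Wd.localGaloisModule w.Completion) 1, x = 0)) :=
    fun w hw ↦ absurd (Subsingleton.elim w _) hw
  have hdsq₀ := forall_sq_ne_completion_of_neg (show (discr K : ℚ) < 0 by exact_mod_cast hdneg) Rat.infinitePlace
  exact ⟨fun hstrict ↦ natCard_selmerGroup_twist_eq_mul_two_of_menu₅_inl W hd0 hCd hw₀ hΔ' hdsq₀ hfin hinf hstrict,
    fun hns ↦ natCard_selmerGroup_twist_mul_two_eq_of_menu₅_inl W hd0 hCd hw₀ hΔ' hdsq₀ hfin hinf hns⟩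

/-! ## §2 A⁺-alg: on the `Ш[2] = 0` cells every Tamagawa-odd Heegner twin is 2-Selmer-minimal -/

/-- **`#Sel₂(W) = 1 ⟹ #Sel₂(Wd) = 2` for EVERY Tamagawa-odd Heegner twin on `Δ > 0`** (the Mazur–Rubin prime-twisting step of the Δ>0 supply
is FREE on the cells with `Ш(E/ℚ)[2] = 0`, `E(ℚ)/2 = 0`): the twist raises or lowers by one `2`-dimension, and it cannot lower below `1`.
[cite: MazurRubin2010, Cor. 3.4 (i)] [cite: Kramer1981, Thm. 1] -/
theorem natCard_selmerGroup_twin_eq_two_of_posDisc_of_natCard_selmerGroup_eq_one {K : Type} [Field K] [NumberField K]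
    (hΔ : 0 < W.Δ) (hTam : Odd W.tamagawaProduct) (hK : IsImaginaryQuadratic K) (hodd : Odd (discr K))
    (hH : SatisfiesHeegnerHypothesis (W.conductorNorm ℤ) K)
    (Wd : WeierstrassCurve ℚ) [Wd.IsElliptic] (hWd : ∃ C : VariableChange ℚ, C • W.quadraticTwist (discr K : ℚ) = Wd)
    (hDEF : padicValNat 2 Wd.tamagawaProduct = 0) (hSelW : Nat.card (W.selmerGroup 2) = 1) :
    Nat.card (Wd.selmerGroup 2) = 2 := by
  obtain ⟨hraise, hlower⟩ := natCard_selmerGroup_twin_eq_mul_two_or_of_posDisc_of_padicValNat_eq_zero W hΔ hTam hK hodd hH Wd hWd hDEF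
  simp only [Nat.cast_ofNat] at hraise hlower
  by_cases hstrict : ∀ c ∈ (W.kummerSelmerStructure ((2 : ℕ) : ℤ)).selmerGroup,
      galoisCohomology.localization (W.torsionGaloisModule ((2 : ℕ) : ℤ)) (Sum.inl Rat.infinitePlace) 1 c = 0
  · rw [hraise hstrict, hSelW]
  · push Not at hstrict
    obtain ⟨c, hc, hne⟩ := hstrict
    have h := hlower ⟨c, hc, hne⟩
    rw [hSelW] at h
    omega

/-! ## §3 Necessity of the real-place clause on the `(ℤ/2)²`-cells -/

/-- **Strict at `∞` with `#Sel₂(W) = 4` ⟹ `#Sel₂(Wd) = 8`**: on the real-strict `(ℤ/2)²`-cells of `Δ > 0` NO Tamagawa-odd Heegner twin is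
2-Selmer-minimal (the twist raises). [cite: MazurRubin2010, Cor. 3.4 (i)] [cite: Kramer1981, Thm. 1] -/
theorem natCard_selmerGroup_twin_eq_eight_of_posDisc_of_strict_real_of_natCard_selmerGroup_eq_four {K : Type} [Field K] [NumberField K]
    (hΔ : 0 < W.Δ) (hTam : Odd W.tamagawaProduct) (hK : IsImaginaryQuadratic K) (hodd : Odd (discr K))
    (hH : SatisfiesHeegnerHypothesis (W.conductorNorm ℤ) K)
    (Wd : WeierstrassCurve ℚ) [Wd.IsElliptic] (hWd : ∃ C : VariableChange ℚ, C • W.quadraticTwist (discr K : ℚ) = Wd)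
    (hDEF : padicValNat 2 Wd.tamagawaProduct = 0) (hSelW : Nat.card (W.selmerGroup 2) = 4)
    (hstrict : ∀ c ∈ (W.kummerSelmerStructure ((2 : ℕ) : ℤ)).selmerGroup,
      galoisCohomology.localization (W.torsionGaloisModule ((2 : ℕ) : ℤ)) (Sum.inl Rat.infinitePlace) 1 c = 0) :
    Nat.card (Wd.selmerGroup 2) = 8 := by
  obtain ⟨hraise, -⟩ := natCard_selmerGroup_twin_eq_mul_two_or_of_posDisc_of_padicValNat_eq_zero W hΔ hTam hK hodd hH Wd hWd hDEF
  simp only [Nat.cast_ofNat] at hraise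
  rw [hraise hstrict, hSelW]

/-- **NECESSITY of the real-place clause of the Δ>0 supply cut**: if `#Sel₂(W) = 4` and some Tamagawa-odd Heegner twin `Wd` is 2-Selmer-minimal
(`#Sel₂(Wd) = 2`), then SOME `2`-Selmer class of `W` is non-trivial at the real place (`Sel₂(W)` is not strict at `∞`).  So a supply that hands a
Tamagawa-odd Sel₂-minimal twin on the `(ℤ/2)²`-cells can only be asked on the real-non-strict ones; the real-strict `(ℤ/2)²`-cells are residual.
[cite: MazurRubin2010, Cor. 3.4 (i)] [cite: Kramer1981, Thm. 1] -/
theorem exists_selmer_localization_real_ne_zero_of_posDisc_of_minimalTwin_of_natCard_selmerGroup_eq_four {K : Type} [Field K]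
    [NumberField K]
    (hΔ : 0 < W.Δ) (hTam : Odd W.tamagawaProduct) (hK : IsImaginaryQuadratic K) (hodd : Odd (discr K))
    (hH : SatisfiesHeegnerHypothesis (W.conductorNorm ℤ) K)
    (Wd : WeierstrassCurve ℚ) [Wd.IsElliptic] (hWd : ∃ C : VariableChange ℚ, C • W.quadraticTwist (discr K : ℚ) = Wd)
    (hDEF : padicValNat 2 Wd.tamagawaProduct = 0) (hSelW : Nat.card (W.selmerGroup 2) = 4) (hSel : Nat.card (Wd.selmerGroup 2) = 2) :
    ∃ c ∈ (W.kummerSelmerStructure ((2 : ℕ) : ℤ)).selmerGroup,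
      galoisCohomology.localization (W.torsionGaloisModule ((2 : ℕ) : ℤ)) (Sum.inl Rat.infinitePlace) 1 c ≠ 0 := by
  by_contra h
  push Not at h
  have h8 := natCard_selmerGroup_twin_eq_eight_of_posDisc_of_strict_real_of_natCard_selmerGroup_eq_four W hΔ hTam hK hodd hH Wd hWd hDEF
    hSelW h
  omega

end Summit.BirchSwinnertonDyer.BirchSwinnertonDyer.Theorems.GenusExact.PlusDescent

end
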